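import Summits.QuantumFields.BalabanUV.Beta.FP.CombSliceUnimodular
import Summits.QuantumFields.BalabanUV.Beta.FP.SliceExchangeJets

/-!
# Second variations of forest-triangular 2-jets are blockwise (road «FP», route T: the MODEL half of the (UNI) JET LETTERS of `NestedStepLawOneShotJets`)

Owner file of road «FP» (unit `b2b-balaban-beta-d1-p3`, gen 17), TID-LETTER-SPEC § B (v).  The analysis-free one-shot step law
`NestedStepLawOneShotJets.secondVar_oneShot_nestedStepLaw_jets_of_uni` (p308750) carries (UNI) as two JET letters: `secondVar` of the 2-jet of each comb
Faddeev–Popov operator vanishes.  leaf-06's `CombSliceUnimodular` (p308320) gives the ORDER-0 statement (`|det| = 1`) from forest-triangularity.  This file lifts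
forest-triangularity to 2-jets:
* §1 `secondVar_eq_sum_of_logAbsDet_eq_sum` — if `log|det A| = Σ_{k∈s} log|det B_k| + c` near `0` for `C²` matrix curves, then `secondVar A = Σ_k secondVar B_k` (the
  finite-sum form of `SliceExchangeDefect.secondVar_eq_add_of_logAbsDet_eq_add`).
* §2 **`secondVar_forestTriangular_jets`** — if the three jets `M₀, M₁, M₂` are triangular along ONE ranked forest (leaf-06's data `site rk parent`, letters `hrk`, `hloc`)
  and every site block of `M₀` is non-degenerate, then `secondVar M₀ M₁ M₂ = Σ_x secondVar (M₀|ₓ) (M₁|ₓ) (M₂|ₓ)` (site blocks `toSquareBlock site x`): along the quadratic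
  Taylor curve the matrix stays forest-triangular, `det = ∏_x det(block_x)` (`CombSliceUnimodular.det_of_forestTriangular`), and §1.
* **`secondVar_forestTriangular_jets_eq_zero`** — hence if every site block's 2-jet has `secondVar = 0`, the whole 2-jet has `secondVar = 0` — the (UNI) jet letter's shape.
* §3 `secondVar_unique` (`secondVar` of a 1×1 2-jet `= c∕a − (b∕a)²`) and `secondVar_unique_eq_zero` (`a·c = b²` ⇒ `0`: the colour-stripped scalar site blocks `(±1, ±s, ±s²)`).
HONEST: model-level calculus; which blocks the torus comb rows produce is the dictionary's ((T-ID)); nothing here is the road's (SDF), (D1), BetaPertH, continuum or Clay.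
HONEST DEPENDENCY: continuum YM on T⁴ ⇐ BetaPertH ∧ nine spine estimates (0/9 proved); BetaPertH ⇐ (D1) ∧ (D4) ∧ CAP+tail; G-an2-4 gates asym, D1 and NE2/3/4.
-/

noncomputable section

namespace Summit.QuantumFields.BalabanUV.Beta.FP.ForestTriangularJets

open Matrix Filter Finset
open scoped Topology BigOperators
open Summit.QuantumFields.BalabanUV.Beta.D1BFx.LogDetSecondVariation (secondVar hasDerivAt_logAbsDet hasDerivAt_trace_inv_mul)
open Summit.QuantumFields.BalabanUV.Beta.D1BFx.SliceTransferJetsAlgebra (secondVar_one)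
open Summit.QuantumFields.BalabanUV.Beta.D1BFx.SliceTransferJets (pc lc of_pc of_lc of_pc_zero of_lc_zero hasDerivAt_pc hasDerivAt_lc)
open Summit.QuantumFields.BalabanUV.Beta.FP.SliceExchangeDefect (secondVar_eq_add_of_logAbsDet_eq_add)
open Summit.QuantumFields.BalabanUV.Beta.FP.CombSliceUnimodular (det_of_forestTriangular)
open Literature.Analysis.Calculus (eventually_det_ne_zero)

/-! ## §1 A finite sum of `log|det|`'s: second variations add -/

section Sum

variable {ι : Type*} [Fintype ι] [DecidableEq ι] {β : Type*} {κ : β → Type*} [∀ k, Fintype (κ k)] [∀ k, DecidableEq (κ k)]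

/-- [folklore] **SECOND VARIATIONS ADD UNDER A FINITE `log|det|` SUM**: `A` a `C²` matrix curve non-degenerate at `0`, `B k` (`k ∈ s`) `C²` matrix curves non-degenerate
at `0`, `log|det A| = Σ_{k∈s} log|det B_k| + c` near `0` ⇒ `secondVar (A 0) (A₁ 0) A₂ = Σ_{k∈s} secondVar (B_k 0) (B_k₁ 0) (B_k₂)`. -/
theorem secondVar_eq_sum_of_logAbsDet_eq_sum (s : Finset β) {A A₁ : ℝ → ι → ι → ℝ} {A₂ : Matrix ι ι ℝ}
    {B B₁ : ∀ k : β, ℝ → κ k → κ k → ℝ} {B₂ : ∀ k : β, Matrix (κ k) (κ k) ℝ} {c : ℝ}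
    (hA : ∀ᶠ u in 𝓝 (0 : ℝ), HasDerivAt A (A₁ u) u) (hA₁ : HasDerivAt A₁ (A₂ : ι → ι → ℝ) 0) (hdA : (Matrix.of (A 0)).det ≠ 0)
    (hB : ∀ k ∈ s, ∀ᶠ u in 𝓝 (0 : ℝ), HasDerivAt (B k) (B₁ k u) u) (hB₁ : ∀ k ∈ s, HasDerivAt (B₁ k) (B₂ k : κ k → κ k → ℝ) 0)
    (hdB : ∀ k ∈ s, (Matrix.of (B k 0)).det ≠ 0)
    (heq : ∀ᶠ u in 𝓝 (0 : ℝ), Real.log |(Matrix.of (A u)).det| = ∑ k ∈ s, Real.log |(Matrix.of (B k u)).det| + c) :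
    secondVar (Matrix.of (A 0)) (Matrix.of (A₁ 0)) A₂ = ∑ k ∈ s, secondVar (Matrix.of (B k 0)) (Matrix.of (B₁ k 0)) (B₂ k) := by
  -- every `B k` is differentiable and non-degenerate near `0`
  have hdB' : ∀ k ∈ s, ∀ᶠ u in 𝓝 (0 : ℝ), (Matrix.of (B k u)).det ≠ 0 := fun k hk =>
    eventually_det_ne_zero (hB k hk).self_of_nhds.hasFDerivAt (hdB k hk)
  have hall : ∀ᶠ u in 𝓝 (0 : ℝ), ∀ k ∈ s, HasDerivAt (B k) (B₁ k u) u ∧ (Matrix.of (B k u)).det ≠ 0 :=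
    (s.eventually_all.2 fun k hk => (hB k hk).and (hdB' k hk))
  -- `φ = Σ log|det B_k| + c` and its two derivatives
  have hφ : ∀ᶠ u in 𝓝 (0 : ℝ), HasDerivAt (fun u => ∑ k ∈ s, Real.log |(Matrix.of (B k u)).det| + c)
      ((fun u => ∑ k ∈ s, ((Matrix.of (B k u))⁻¹ * Matrix.of (B₁ k u)).trace) u) u := by
    filter_upwards [hall] with u hu
    exact (HasDerivAt.fun_sum fun k hk => hasDerivAt_logAbsDet (A₁ := Matrix.of (B₁ k u)) (hu k hk).1 (hu k hk).2).add_const c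
  have hφ₁ : HasDerivAt (fun u => ∑ k ∈ s, ((Matrix.of (B k u))⁻¹ * Matrix.of (B₁ k u)).trace)
      (∑ k ∈ s, secondVar (Matrix.of (B k 0)) (Matrix.of (B₁ k 0)) (B₂ k)) 0 :=
    HasDerivAt.fun_sum fun k hk => hasDerivAt_trace_inv_mul (hB k hk).self_of_nhds (hB₁ k hk) (hdB k hk)
  -- compare with the trivial curve `1`
  have h1 : ∀ᶠ u in 𝓝 (0 : ℝ), HasDerivAt (fun _ : ℝ => Matrix.of.symm (1 : Matrix ι ι ℝ)) ((fun _ : ℝ => Matrix.of.symm (0 : Matrix ι ι ℝ)) u) u :=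
    Eventually.of_forall fun u => hasDerivAt_const u _
  have h1₁ : HasDerivAt (fun _ : ℝ => Matrix.of.symm (0 : Matrix ι ι ℝ)) ((0 : Matrix ι ι ℝ) : ι → ι → ℝ) 0 := hasDerivAt_const 0 _
  have hd1 : (Matrix.of ((fun _ : ℝ => Matrix.of.symm (1 : Matrix ι ι ℝ)) 0)).det ≠ 0 := by
    simp only [Equiv.apply_symm_apply, Matrix.det_one]; exact one_ne_zero
  have heq' : ∀ᶠ u in 𝓝 (0 : ℝ), Real.log |(Matrix.of (A u)).det|
      = Real.log |(Matrix.of ((fun _ : ℝ => Matrix.of.symm (1 : Matrix ι ι ℝ)) u)).det| + (fun u => ∑ k ∈ s, Real.log |(Matrix.of (B k u)).det| + c) u := by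
    filter_upwards [heq] with u hu
    simp only [Equiv.apply_symm_apply, Matrix.det_one, abs_one, Real.log_one, zero_add]
    exact hu
  have h := secondVar_eq_add_of_logAbsDet_eq_add hA hA₁ hdA h1 h1₁ hd1 hφ hφ₁ heq'
  simp only [Equiv.apply_symm_apply, secondVar_one, zero_add] at h
  exact h

end Sum

/-! ## §2 Forest-triangular 2-jets -/

section Forest

variable {t σ : Type*} [Fintype t] [DecidableEq t] [Fintype σ] [DecidableEq σ]

omit [Fintype t] [DecidableEq t] [Fintype σ] [DecidableEq σ] in
/-- [folklore] the quadratic Taylor curve of forest-triangular jets is forest-triangular. -/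
theorem forestTriangular_pc (M₀ M₁ M₂ : Matrix t t ℝ) (site : t → σ) (parent : σ → Option σ)
    (h₀ : ∀ i j, M₀ i j ≠ 0 → site j = site i ∨ parent (site i) = some (site j))
    (h₁ : ∀ i j, M₁ i j ≠ 0 → site j = site i ∨ parent (site i) = some (site j))
    (h₂ : ∀ i j, M₂ i j ≠ 0 → site j = site i ∨ parent (site i) = some (site j)) (u : ℝ) :
    ∀ i j, Matrix.of (pc M₀ M₁ M₂ u) i j ≠ 0 → site j = site i ∨ parent (site i) = some (site j) := by
  intro i j hij
  by_contra hc
  have e0 : M₀ i j = 0 := by by_contra h; exact hc (h₀ i j h)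
  have e1 : M₁ i j = 0 := by by_contra h; exact hc (h₁ i j h)
  have e2 : M₂ i j = 0 := by by_contra h; exact hc (h₂ i j h)
  apply hij
  rw [of_pc]
  simp only [Matrix.add_apply, Matrix.smul_apply, e0, e1, e2, smul_zero, add_zero]

omit [Fintype t] [DecidableEq t] [Fintype σ] [DecidableEq σ] in
/-- [folklore] site blocks commute with the Taylor curve: `(pc M₀ M₁ M₂ u)|ₓ = pc (M₀|ₓ) (M₁|ₓ) (M₂|ₓ) u`. -/
theorem toSquareBlock_pc (M₀ M₁ M₂ : Matrix t t ℝ) (site : t → σ) (x : σ) (u : ℝ) :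
    (Matrix.of (pc M₀ M₁ M₂ u)).toSquareBlock site x = Matrix.of (pc (M₀.toSquareBlock site x) (M₁.toSquareBlock site x) (M₂.toSquareBlock site x) u) := by
  rw [of_pc, of_pc]
  ext i j
  simp only [Matrix.toSquareBlock_def, Matrix.add_apply, Matrix.smul_apply, Matrix.of_apply]

/-- [folklore] **SECOND VARIATIONS OF FOREST-TRIANGULAR 2-JETS ARE BLOCKWISE.**  If `M₀, M₁, M₂` are triangular along one ranked forest (`site rk parent`, `hrk`) and
every site block of `M₀` is non-degenerate, then `secondVar M₀ M₁ M₂ = Σ_{x ∈ image site} secondVar (M₀|ₓ) (M₁|ₓ) (M₂|ₓ)`. -/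
theorem secondVar_forestTriangular_jets (M₀ M₁ M₂ : Matrix t t ℝ) (site : t → σ) (rk : σ → ℕ) (parent : σ → Option σ)
    (hrk : ∀ x p, parent x = some p → rk p < rk x)
    (h₀ : ∀ i j, M₀ i j ≠ 0 → site j = site i ∨ parent (site i) = some (site j))
    (h₁ : ∀ i j, M₁ i j ≠ 0 → site j = site i ∨ parent (site i) = some (site j))
    (h₂ : ∀ i j, M₂ i j ≠ 0 → site j = site i ∨ parent (site i) = some (site j))
    (hdet : ∀ x ∈ univ.image site, (M₀.toSquareBlock site x).det ≠ 0) :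
    secondVar M₀ M₁ M₂ = ∑ x ∈ univ.image site, secondVar (M₀.toSquareBlock site x) (M₁.toSquareBlock site x) (M₂.toSquareBlock site x) := by
  -- pointwise: `det (pc u) = ∏ det (pc of the blocks u)`
  have hdet_pc : ∀ u : ℝ, (Matrix.of (pc M₀ M₁ M₂ u)).det
      = ∏ x ∈ univ.image site, (Matrix.of (pc (M₀.toSquareBlock site x) (M₁.toSquareBlock site x) (M₂.toSquareBlock site x) u)).det := fun u => by
    rw [det_of_forestTriangular (Matrix.of (pc M₀ M₁ M₂ u)) site rk parent hrk (forestTriangular_pc M₀ M₁ M₂ site parent h₀ h₁ h₂ u)]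
    exact Finset.prod_congr rfl fun x _ => by rw [toSquareBlock_pc]
  -- the whole matrix is non-degenerate at `0`
  have hd0 : (Matrix.of (pc M₀ M₁ M₂ 0)).det ≠ 0 := by
    rw [hdet_pc 0]
    exact Finset.prod_ne_zero_iff.2 fun x hx => by rw [of_pc_zero]; exact hdet x hx
  -- the blocks are non-degenerate near `0`, hence `log|det| = Σ log|det block|` near `0`
  have hblk : ∀ x ∈ univ.image site, ∀ᶠ u in 𝓝 (0 : ℝ),
      (Matrix.of (pc (M₀.toSquareBlock site x) (M₁.toSquareBlock site x) (M₂.toSquareBlock site x) u)).det ≠ 0 := fun x hx =>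
    eventually_det_ne_zero (hasDerivAt_pc _ _ _ 0).hasFDerivAt (by rw [of_pc_zero]; exact hdet x hx)
  have hall : ∀ᶠ u in 𝓝 (0 : ℝ), ∀ x ∈ univ.image site,
      (Matrix.of (pc (M₀.toSquareBlock site x) (M₁.toSquareBlock site x) (M₂.toSquareBlock site x) u)).det ≠ 0 :=
    (univ.image site).eventually_all.2 hblk
  have heq : ∀ᶠ u in 𝓝 (0 : ℝ), Real.log |(Matrix.of (pc M₀ M₁ M₂ u)).det|
      = ∑ x ∈ univ.image site, Real.log |(Matrix.of (pc (M₀.toSquareBlock site x) (M₁.toSquareBlock site x) (M₂.toSquareBlock site x) u)).det| + 0 := by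
    filter_upwards [hall] with u hu
    rw [hdet_pc u, Finset.abs_prod, Real.log_prod fun x hx => abs_ne_zero.2 (hu x hx), add_zero]
  have h := secondVar_eq_sum_of_logAbsDet_eq_sum (univ.image site)
    (A := pc M₀ M₁ M₂) (A₁ := lc M₁ M₂) (A₂ := M₂)
    (B := fun x => pc (M₀.toSquareBlock site x) (M₁.toSquareBlock site x) (M₂.toSquareBlock site x))
    (B₁ := fun x => lc (M₁.toSquareBlock site x) (M₂.toSquareBlock site x)) (B₂ := fun x => M₂.toSquareBlock site x)
    (Eventually.of_forall fun u => hasDerivAt_pc M₀ M₁ M₂ u) (hasDerivAt_lc M₁ M₂ 0) hd0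
    (fun x _ => Eventually.of_forall fun u => hasDerivAt_pc _ _ _ u) (fun x _ => hasDerivAt_lc _ _ 0)
    (fun x hx => by rw [of_pc_zero]; exact hdet x hx) heq
  simp only [of_pc_zero, of_lc_zero] at h
  exact h

/-- [folklore] **THE (UNI) JET LETTER'S SHAPE**: forest-triangular 2-jet, every site block non-degenerate with vanishing `secondVar` ⇒ `secondVar M₀ M₁ M₂ = 0`. -/
theorem secondVar_forestTriangular_jets_eq_zero (M₀ M₁ M₂ : Matrix t t ℝ) (site : t → σ) (rk : σ → ℕ) (parent : σ → Option σ)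
    (hrk : ∀ x p, parent x = some p → rk p < rk x)
    (h₀ : ∀ i j, M₀ i j ≠ 0 → site j = site i ∨ parent (site i) = some (site j))
    (h₁ : ∀ i j, M₁ i j ≠ 0 → site j = site i ∨ parent (site i) = some (site j))
    (h₂ : ∀ i j, M₂ i j ≠ 0 → site j = site i ∨ parent (site i) = some (site j))
    (hdet : ∀ x ∈ univ.image site, (M₀.toSquareBlock site x).det ≠ 0)
    (hzero : ∀ x ∈ univ.image site, secondVar (M₀.toSquareBlock site x) (M₁.toSquareBlock site x) (M₂.toSquareBlock site x) = 0) :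
    secondVar M₀ M₁ M₂ = 0 := by
  rw [secondVar_forestTriangular_jets M₀ M₁ M₂ site rk parent hrk h₀ h₁ h₂ hdet]
  exact Finset.sum_eq_zero hzero

end Forest

/-! ## §3 Scalar site blocks (the colour-stripped literal) -/

section Scalar

variable {ι : Type*} [Fintype ι] [DecidableEq ι] [Unique ι]

/-- [folklore] **`secondVar` OF A 1×1 2-JET**: on a one-element index type, `secondVar A B C = C∕A − (B∕A)²` (entries at the unique index). -/
theorem secondVar_unique (A B C : Matrix ι ι ℝ) (hA : A default default ≠ 0) :
    secondVar A B C = C default default / A default default - (B default default / A default default) ^ 2 := by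
  have hdet : A.det = A default default := Matrix.det_eq_elem_of_subsingleton A default
  have hAi : A⁻¹ = (A default default)⁻¹ • (1 : Matrix ι ι ℝ) := by
    rw [Matrix.inv_def, Matrix.adjugate_subsingleton, hdet, Ring.inverse_eq_inv']
  unfold secondVar
  simp only [hAi, Matrix.smul_mul, Matrix.one_mul, Matrix.mul_smul, Matrix.trace, Matrix.diag_apply, Fintype.sum_unique, Matrix.smul_apply,
    Matrix.mul_apply, smul_eq_mul]
  field_simp

/-- [folklore] **THE SCALAR (UNI) JET LETTER**: a 1×1 2-jet `(a, b, c)` with `a ≠ 0` and `a·c = b²` has `secondVar = 0` (e.g. the colour-stripped rotation jets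
`(1, s, s²)` or `(−1, −s, −s²)`). -/
theorem secondVar_unique_eq_zero (A B C : Matrix ι ι ℝ) (hA : A default default ≠ 0) (h : A default default * C default default = B default default ^ 2) :
    secondVar A B C = 0 := by
  rw [secondVar_unique A B C hA]
  field_simp
  linear_combination h

end Scalar

end Summit.QuantumFields.BalabanUV.Beta.FP.ForestTriangularJets

end
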